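import Literature.NumberTheory.EllipticCurves.SteinWuthrich2013.MultiplicativeLeadingTerm
import Literature.NumberTheory.EllipticCurves.TateCurve.UniformizationPoints
import Literature.NumberTheory.EllipticCurves.TateCurve.UniformizationSurjective
import Literature.NumberTheory.EllipticCurves.PAdicHeightsSplitReductionProofs
import Literature.NumberTheory.EllipticCurves.TateCurve.UniformizationFormalGroup
import Literature.NumberTheory.EllipticCurves.TateCurve.UniformizationResidueUnits
import Literature.NumberTheory.EllipticCurves.TateCurve.TateFormalAdditionIdentity
import Literature.NumberTheory.EllipticCurves.MinimalModelReduction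
import Literature.NumberTheory.EllipticCurves.PAdicHeightsTateValuationProofs
import Literature.NumberTheory.EllipticCurves.CanonicalPAdicHeightThetaProofs
import Literature.NumberTheory.EllipticCurves.VariableChangePoints
import Literature.NumberTheory.EllipticCurves.FormalGroupLawPadicProofs
import HarnessLib

/-!
# Tate parameters of the rational points of `E₁(ℚ_p)` at a SPLIT multiplicative prime, in
# Stein–Wuthrich's coordinates (proofs only)

Topic `Literature/NumberTheory/EllipticCurves` (cluster `SteinWuthrich2013`); proof file (theorems
only, nothing asserted, no definition). Cell `bsd-eis`, seat `bsd-eis-k5-c4` g3: input (T2 a–d) of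
the discharge of the named fact `exists_isSplitMultCanonical` (`MultiplicativeHeightExistence.lean`;
crux 4 `BSDpOnCellC` of route `EisensteinPrimes`, stmt-BirchSwinnertonDyer-19034,
`stub_publishedFacts` conjunct `hHs`) — the "uniformisation data" hypotheses `hC`, `hυ0`, `hυX`,
`hυadd`, `hυsub` of `tateSigma_theta_of_uniformization`
(`MultiplicativeHeightThetaOfUniformizationProofs.lean`) over `K = ℚ_p`.

Let `W/ℚ` be a globally minimal elliptic curve, `p` a prime and `Dq : TateParameterData W p` (split
multiplicative reduction at `p`, Tate parameter `q = Dq.q`). Stein–Wuthrich 2013 §4.2 (p. 15): "We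
use Tate's `p`-adic uniformization … `ψ : ℚ̄_p^× → E(ℚ̄_p)` … The image of `ℤ_p^×` under `ψ` is equal
to the subgroup of points of `E(ℚ_p)` lying on the connected component … Let `C` be the constant
such that `ψ^*(ω_E) = C · du/u` … `u ∈ 1 + pℤ_p` is the unique preimage of `P ∈ Ê(pℤ_p)`". In the
tree's currency (ATAEC V.3.1/V.5.3 PROVED in `TateCurve/`):

* `exists_variableChange_tateCurve` — a change of variables `C` over `ℚ_p` with
  `C • (W ⊗ ℚ_p) = E_q` (V.5.3, the tree's `exists_tateParameter_of_hasSplitMultiplicativeReduction'`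
  with `q` pinned by `tateParameter_unique`) which is `ℤ_p`-INTEGRAL with `u ∈ ℤ_p^×` (AEC
  VII.1.3(b): both equations are minimal — `isMinimal_baseChange_padic_of_isGloballyMinimal`,
  `tateCurve_isMinimal` —, `exists_variableChange_baseChange_eq_of_isMinimal`);
* `uniformisationScaleSq_eq` — SW's `C² = c₆(E_q)c₄(E)/(c₄(E_q)c₆(E))` is `(u⁻¹)²` for this `C`;
* `exists_oneUnit_tatePoint_eq` — every rational point `P = (x,y)` of `E₁(ℚ_p)` is `ψ(φ(υ))` for a
  unique one-unit `υ ∈ 1 + pℤ_p`, `υ ≠ 1` (ATAEC §V.4, `φ(1+𝔪) = E_{q,1}`: the tree's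
  `exists_tate_eq_of_one_lt_norm`; uniqueness from `ker φ = q^ℤ`);
* `exists_splitUniformizationData` — the package: `C ≠ 0` in SW's sense, `C² = uniformisationScaleSq`,
  and parameters `υ(P)` of the rational points of `E₁(ℚ_p)` with `υ(P) ∈ 1 + pℤ_p ∖ {1}` (so
  `υ(P) ∉ q^ℤ`), `X(υ(P),q) = u⁻²x(P) − u⁻²r`, `Y(υ(P),q) = …`, `υ(P+Q) = υ(P)υ(Q)`,
  `υ(P−Q) = υ(P)υ(Q)⁻¹` (`tatePoint_mul`, `tatePoint_inv`).

What is NOT here: the last uniformisation hypothesis `hυσ`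
(`tateSigmaSq q (coshOfSq (logUnitParamSq …)) = θ(υ)²/υ`), which needs `cosh(log_p υ) = (υ+υ⁻¹)/2`
and `log_E(z(P)) = ±u⁻¹ log_p υ(P)` (sequel; tools: `TateSigmaThetaProofs.lean`,
`LocalFields/PadicOneUnitHomRigidity.lean`).

## Sources

* J. H. Silverman, *Advanced Topics in the Arithmetic of Elliptic Curves* (1994), Thm. V.3.1 (c),
  §V.4 (PDF pp. 399–405), Thm. V.5.3 (PDF pp. 407–409). [SilvermanATAEC1994]
* J. H. Silverman, *The Arithmetic of Elliptic Curves* (2009), Prop. VII.1.3(b). [SilvermanAEC2009]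
* W. Stein, C. Wuthrich, Math. Comp. 82 (2013), §4.2 (p. 15). [SteinWuthrich2013]
-/

noncomputable section

open scoped Classical

open WeierstrassCurve Literature.NumberTheory.EllipticCurves
  Literature.NumberTheory.EllipticCurves.TateCurve

namespace Literature.NumberTheory.EllipticCurves.SteinWuthrich2013

variable {W : WeierstrassCurve ℚ} {p : ℕ} [Fact p.Prime]

/-- `‖x‖ ≤ 1 ↔ x ∈ ℤ_p` in `ℚ_p`. [folklore] -/
private theorem padic_norm_le_one_iff' (x : ℚ_[p]) :
    ‖x‖ ≤ 1 ↔ x ∈ Set.range (algebraMap ℤ_[p] ℚ_[p]) :=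
  ⟨fun h => ⟨⟨x, h⟩, rfl⟩, by rintro ⟨y, rfl⟩; exact y.2⟩

/-- The Weierstrass equation of `E_q`, expanded, from non-singularity. [folklore] -/
private theorem tate_eq_of_nonsingular {q x y : ℚ_[p]}
    (h : (tateCurve q).toAffine.Nonsingular x y) :
    y ^ 2 + x * y = x ^ 3 + tateA4 q * x + tateA6 q := by
  have h' := h.1
  rw [WeierstrassCurve.Affine.equation_iff] at h'
  simp only [tateCurve] at h'
  linear_combination h'

/-! ### The integral isomorphism `C • (W ⊗ ℚ_p) = E_q` -/

/-- **An INTEGRAL `ℚ_p`-isomorphism onto the Tate curve at a split multiplicative prime.** For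
`W/ℚ` globally minimal and a Tate parameter datum `Dq` at `p` there is a change of variables
`C = (u, r, s, t)` over `ℚ_p` with `C • (W ⊗ ℚ_p) = E_q`, `q = Dq.q` (ATAEC V.5.3: split
multiplicative ⇒ `E ≅ E_q` over `ℚ_p`, with `q` THE Tate parameter), and `‖u‖ = 1`, `‖r‖ ≤ 1`
(AEC VII.1.3(b): `W ⊗ ℚ_p` and `E_q` are both minimal equations, so `C` is defined over `ℤ_p`).
[Silverman ATAEC Thm. V.5.3; AEC Prop. VII.1.3(b)]
[cite: SilvermanATAEC1994, Thm. V.5.3 (PDF pp. 407–409)] [cite: SilvermanAEC2009, Prop. VII.1.3(b)] -/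
theorem exists_variableChange_tateCurve [W.IsElliptic] [W.IsGloballyMinimal]
    (Dq : TateParameterData W p) :
    ∃ C : VariableChange ℚ_[p], C • W.baseChange ℚ_[p] = tateCurve Dq.q ∧
      ‖(C.u : ℚ_[p])‖ = 1 ∧ ‖C.r‖ ≤ 1 ∧ ‖C.s‖ ≤ 1 ∧ ‖C.t‖ ≤ 1 := by
  set E : WeierstrassCurve ℚ_[p] := W.baseChange ℚ_[p] with hE
  -- V.5.3: `E ≅ E_{q'}` over `ℚ_p` for a Tate parameter `q'`, which must be `Dq.q`
  have hsplit : ∃ C : VariableChange ℚ_[p], (C • E).HasSplitMultiplicativeReduction ℤ_[p] :=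
    ⟨_, Dq.split⟩
  obtain ⟨q', hq0', hq', hj', -, C, hC⟩ :=
    exists_tateParameter_of_hasSplitMultiplicativeReduction' ℤ_[p] padic_norm_le_one_iff' E
      hsplit
  have hEj : E.j = (W.j : ℚ_[p]) := by
    show (W.map (algebraMap ℚ ℚ_[p])).j = _
    rw [WeierstrassCurve.map_j, eq_ratCast]
  have hqq : q' = Dq.q :=
    tateParameter_unique (E := E) hq0' hq' hj' Dq.q_ne_zero Dq.norm_q_lt_one
      (Dq.tateJ_eq.trans hEj.symm)
  subst hqq
  refine ⟨C, hC, ?_⟩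
  -- both `E` and `C • E = E_q` are minimal, so `C` is `ℤ_p`-integral (AEC VII.1.3(b))
  obtain ⟨v, hv⟩ := (Rat.HeightOneSpectrum.primesEquiv (R := NumberField.RingOfIntegers ℚ)).surjective
    ⟨p, Fact.out⟩
  have hvp : ((Rat.HeightOneSpectrum.primesEquiv v : Nat.Primes) : ℕ) = p :=
    congrArg Subtype.val hv
  subst hvp
  set ℓ : ℕ := ((Rat.HeightOneSpectrum.primesEquiv v : Nat.Primes) : ℕ) with hℓ
  haveI : E.IsMinimal ℤ_[ℓ] := isMinimal_baseChange_padic_of_isGloballyMinimal W v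
  haveI : (C • E).IsMinimal ℤ_[ℓ] := by
    rw [hC]; exact tateCurve_isMinimal _ padic_norm_le_one_iff' Dq.norm_q_lt_one
  have hΔ : E.Δ ≠ 0 := by
    rw [hE, baseChange, map_Δ]
    exact (map_ne_zero _).mpr W.isUnit_Δ.ne_zero
  obtain ⟨D, hD⟩ := exists_variableChange_baseChange_eq_of_isMinimal (R := ℤ_[ℓ]) E C hΔ
  subst hD
  have hu : ((D.baseChange ℚ_[ℓ]).u : ℚ_[ℓ]) = ((D.u : ℤ_[ℓ]) : ℚ_[ℓ]) := rfl
  have hr : (D.baseChange ℚ_[ℓ]).r = ((D.r : ℤ_[ℓ]) : ℚ_[ℓ]) := rfl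
  have hs : (D.baseChange ℚ_[ℓ]).s = ((D.s : ℤ_[ℓ]) : ℚ_[ℓ]) := rfl
  have ht : (D.baseChange ℚ_[ℓ]).t = ((D.t : ℤ_[ℓ]) : ℚ_[ℓ]) := rfl
  refine ⟨?_, ?_, ?_, ?_⟩
  · rw [hu, PadicInt.padic_norm_e_of_padicInt]
    exact PadicInt.isUnit_iff.mp D.u.isUnit
  · rw [hr, PadicInt.padic_norm_e_of_padicInt]; exact PadicInt.norm_le_one _
  · rw [hs, PadicInt.padic_norm_e_of_padicInt]; exact PadicInt.norm_le_one _
  · rw [ht, PadicInt.padic_norm_e_of_padicInt]; exact PadicInt.norm_le_one _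

/-! ### SW's scale: `C² = c₆(E_q)c₄(E)/(c₄(E_q)c₆(E)) = u⁻²` -/

/-- **SW's uniformisation scale is `u⁻²`**: if `C • (W ⊗ ℚ_p) = E_q` with `C = (u,r,s,t)` and
`‖j(W)‖_p > 1`, then `uniformisationScaleSq W p q = c₆(E_q)c₄(E)/(c₄(E_q)c₆(E)) = (u⁻¹)²`
(`c₄(E_q) = u⁻⁴c₄(E)`, `c₆(E_q) = u⁻⁶c₆(E)`, AEC III.1 Table 3.1; `c₄(E)c₆(E) ≠ 0` as `j ≠ 0, 1728`).
[Stein–Wuthrich 2013, §4.2 (p. 15: "`ψ^*(ω_E) = C · du/u`"); Silverman AEC III.1 Table 3.1]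
[cite: SteinWuthrich2013, §4.2 (p. 15)] [cite: SilvermanAEC2009, III.1 Table 3.1] -/
theorem uniformisationScaleSq_eq [W.IsElliptic] {q : ℚ_[p]} {C : VariableChange ℚ_[p]}
    (hC : C • W.baseChange ℚ_[p] = tateCurve q) (hj : 1 < ‖(W.j : ℚ_[p])‖) :
    uniformisationScaleSq W p q = ((C.u : ℚ_[p])⁻¹) ^ 2 := by
  set E : WeierstrassCurve ℚ_[p] := W.baseChange ℚ_[p] with hE
  haveI : E.IsElliptic := by rw [hE]; infer_instance
  have hEj : E.j = (W.j : ℚ_[p]) := by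
    show (W.map (algebraMap ℚ ℚ_[p])).j = _
    rw [WeierstrassCurve.map_j, eq_ratCast]
  have hj' : 1 < ‖E.j‖ := by rw [hEj]; exact hj
  obtain ⟨hj0, hj1728⟩ := j_ne_zero_and_ne_1728_of_one_lt_norm hj'
  have hc4 : E.c₄ ≠ 0 := by
    intro h0
    apply hj0
    rw [WeierstrassCurve.j, h0]
    ring
  have hc6 : E.c₆ ≠ 0 := by
    intro h0
    apply hj1728
    have hrel := E.c_relation
    rw [h0] at hrel
    rw [WeierstrassCurve.j, show E.c₄ ^ 3 = 1728 * E.Δ by linear_combination -hrel, ← E.coe_Δ',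
      mul_comm (1728 : ℚ_[p]), ← mul_assoc, Units.inv_mul, one_mul]
  have hu : ((C.u⁻¹ : ℚ_[p]ˣ) : ℚ_[p]) = (C.u : ℚ_[p])⁻¹ := Units.val_inv_eq_inv_val _
  unfold uniformisationScaleSq
  rw [← hE, ← hC, variableChange_c₄, variableChange_c₆, hu]
  have hu0 : (C.u : ℚ_[p]) ≠ 0 := C.u.ne_zero
  field_simp

/-! ### The Tate coordinates of sums and inverses (ATAEC V.3.1 (c): `φ` is a homomorphism) -/

/-- **Coordinates of `φ(uv)` from those of `φ(u)`, `φ(v)`** on a Weierstrass equation `T` EQUAL to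
the Tate curve `E_q` (so that points of `T` may be added with `T`'s own instance): if
`(X(u),Y(u)) = (x₁,y₁)`, `(X(v),Y(v)) = (x₂,y₂)` and `(x₁,y₁) + (x₂,y₂) = (x₃,y₃)` on `T`, then
`uv ∉ q^ℤ` and `(X(uv),Y(uv)) = (x₃,y₃)` — Silverman ATAEC V.3.1 (c), `φ(u₁u₂) = φ(u₁) + φ(u₂)` (the
tree's `TateCurve.tatePoint_mul`, modulo the formal addition identities PROVED in
`TateFormalAdditionIdentity.lean`). [cite: SilvermanATAEC1994, Thm. V.3.1 (c) (PDF pp. 397–398)] -/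
theorem tate_coords_add {q : ℚ_[p]} (hq0 : q ≠ 0) (hq : ‖q‖ < 1) (T : WeierstrassCurve ℚ_[p])
    (hT : T = tateCurve q) {u v : ℚ_[p]ˣ} (hu : ∀ n : ℤ, (u : ℚ_[p]) ≠ q ^ n)
    (hv : ∀ n : ℤ, (v : ℚ_[p]) ≠ q ^ n) {x₁ y₁ x₂ y₂ x₃ y₃ : ℚ_[p]}
    (h₁ : T.toAffine.Nonsingular x₁ y₁) (h₂ : T.toAffine.Nonsingular x₂ y₂)
    (h₃ : T.toAffine.Nonsingular x₃ y₃) (hX₁ : tateX q u = x₁) (hY₁ : tateY q u = y₁)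
    (hX₂ : tateX q v = x₂) (hY₂ : tateY q v = y₂)
    (hS : (.some x₁ y₁ h₁ : T.toAffine.Point) + .some x₂ y₂ h₂ = .some x₃ y₃ h₃) :
    (∀ n : ℤ, ((u * v : ℚ_[p]ˣ) : ℚ_[p]) ≠ q ^ n) ∧
      tateX q (u * v : ℚ_[p]ˣ) = x₃ ∧ tateY q (u * v : ℚ_[p]ˣ) = y₃ := by
  subst hT
  have hmul := tatePoint_mul (K := ℚ_[p]) addRelX_eq_zero addRelY_eq_zero hq0 hq u v
  have hPu : tatePoint q u = .some x₁ y₁ h₁ := by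
    rw [tatePoint_of_ne_zpow hq0 hq u hu]
    simp only [hX₁, hY₁]
  have hPv : tatePoint q v = .some x₂ y₂ h₂ := by
    rw [tatePoint_of_ne_zpow hq0 hq v hv]
    simp only [hX₂, hY₂]
  rw [hPu, hPv, hS] at hmul
  have huv : ∀ n : ℤ, ((u * v : ℚ_[p]ˣ) : ℚ_[p]) ≠ q ^ n := by
    intro n hn
    have := tatePoint_of_eq_zpow (q := q) (u * v) hn
    rw [this] at hmul
    exact WeierstrassCurve.Affine.Point.some_ne_zero _ hmul.symm
  refine ⟨huv, ?_, ?_⟩ <;>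
  · rw [tatePoint_of_ne_zpow hq0 hq _ huv] at hmul
    simp only [WeierstrassCurve.Affine.Point.some.injEq] at hmul
    simp only [hmul]

/-- **Coordinates of `φ(u⁻¹) = −φ(u)`**: if `(X(u),Y(u)) = (x,y)` on `T = E_q` then
`(X(u⁻¹),Y(u⁻¹))` are the coordinates of `−(x,y)` on `T` (Silverman ATAEC V.3.1 (c), p. 396; the
tree's `TateCurve.tatePoint_inv`). [cite: SilvermanATAEC1994, Thm. V.3.1 (c) (PDF p. 396)] -/
theorem tate_coords_neg {q : ℚ_[p]} (hq0 : q ≠ 0) (hq : ‖q‖ < 1) (T : WeierstrassCurve ℚ_[p])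
    (hT : T = tateCurve q) {u : ℚ_[p]ˣ} (hu : ∀ n : ℤ, (u : ℚ_[p]) ≠ q ^ n) {x y x' y' : ℚ_[p]}
    (h : T.toAffine.Nonsingular x y) (h' : T.toAffine.Nonsingular x' y')
    (hX : tateX q u = x) (hY : tateY q u = y)
    (hN : -(.some x y h : T.toAffine.Point) = .some x' y' h') :
    (∀ n : ℤ, ((u⁻¹ : ℚ_[p]ˣ) : ℚ_[p]) ≠ q ^ n) ∧
      tateX q (u⁻¹ : ℚ_[p]ˣ) = x' ∧ tateY q (u⁻¹ : ℚ_[p]ˣ) = y' := by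
  subst hT
  have hinv := tatePoint_inv (K := ℚ_[p]) hq0 hq u
  have hPu : tatePoint q u = .some x y h := by
    rw [tatePoint_of_ne_zpow hq0 hq u hu]
    simp only [hX, hY]
  rw [hPu, hN] at hinv
  have hui : ∀ n : ℤ, ((u⁻¹ : ℚ_[p]ˣ) : ℚ_[p]) ≠ q ^ n := by
    intro n hn
    have := tatePoint_of_eq_zpow (q := q) u⁻¹ hn
    rw [this] at hinv
    exact WeierstrassCurve.Affine.Point.some_ne_zero _ hinv.symm
  refine ⟨hui, ?_, ?_⟩ <;>
  · rw [tatePoint_of_ne_zpow hq0 hq _ hui] at hinv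
    simp only [WeierstrassCurve.Affine.Point.some.injEq] at hinv
    simp only [hinv]

/-- **One-units with the same Tate point are equal** (`ker φ = q^ℤ` meets the one-units only in
`1`): if `‖u − 1‖ < 1`, `‖u' − 1‖ < 1` and `(X(u),Y(u)) = (X(u'),Y(u'))` (both off `q^ℤ`), then
`u = u'`. [Silverman ATAEC Thm. V.3.1 (c) (`ker φ = q^ℤ`), §V.4 (`φ(1+𝔪) = E_{q,1}` injective)]
[cite: SilvermanATAEC1994, Thm. V.3.1 (c) (PDF p. 395)] -/
theorem oneUnit_eq_of_tate_eq {q : ℚ_[p]} (hq0 : q ≠ 0) (hq : ‖q‖ < 1) {u u' : ℚ_[p]ˣ}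
    (hu1 : ‖(u : ℚ_[p]) - 1‖ < 1) (hu'1 : ‖(u' : ℚ_[p]) - 1‖ < 1)
    (hu : ∀ n : ℤ, (u : ℚ_[p]) ≠ q ^ n) (hu' : ∀ n : ℤ, (u' : ℚ_[p]) ≠ q ^ n)
    (hX : tateX q u = tateX q u') (hY : tateY q u = tateY q u') : u = u' := by
  -- `φ(u u'⁻¹) = φ(u) − φ(u') = 0`, so `u u'⁻¹ = qⁿ`; norms force `n = 0`
  have hnorm : ∀ w : ℚ_[p]ˣ, ‖(w : ℚ_[p]) - 1‖ < 1 → ‖(w : ℚ_[p])‖ = 1 := by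
    intro w hw
    have := IsUltrametricDist.norm_add_eq_max_of_norm_ne_norm (x := (w : ℚ_[p]) - 1) (y := (1 : ℚ_[p]))
      (by rw [norm_one]; exact hw.ne)
    rw [sub_add_cancel, norm_one, max_eq_right hw.le] at this
    exact this
  have hP : tatePoint q u = tatePoint q u' := by
    rw [tatePoint_of_ne_zpow hq0 hq u hu, tatePoint_of_ne_zpow hq0 hq u' hu']
    simp only [hX, hY]
  have h0 : tatePoint q (u * u'⁻¹) = 0 := by
    rw [tatePoint_mul (K := ℚ_[p]) addRelX_eq_zero addRelY_eq_zero hq0 hq, tatePoint_inv hq0 hq,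
      hP, add_neg_cancel]
  obtain ⟨n, hn⟩ := (tatePoint_eq_zero_iff hq0 hq _).mp h0
  have hn1 : ‖(q : ℚ_[p]) ^ n‖ = 1 := by
    rw [← hn, Units.val_mul, Units.val_inv_eq_inv_val, norm_mul, norm_inv, hnorm u hu1,
      hnorm u' hu'1, inv_one, mul_one]
  have hn0 : n = 0 := by
    rw [norm_zpow] at hn1
    by_contra hne
    have hqpos : 0 < ‖q‖ := norm_pos_iff.mpr hq0
    rcases lt_or_gt_of_ne hne with hlt | hgt
    · have : 1 < ‖q‖ ^ n := (one_lt_zpow_iff_right_of_lt_one₀ hqpos hq).mpr hlt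
      exact absurd hn1 this.ne'
    · have : ‖q‖ ^ n < 1 := (zpow_lt_one_iff_right_of_lt_one₀ hqpos hq).mpr hgt
      exact absurd hn1 this.ne
  rw [hn0, zpow_zero, Units.val_mul, Units.val_inv_eq_inv_val, mul_inv_eq_one₀ u'.ne_zero] at hn
  exact Units.ext hn

/-! ### One-unit Tate parameters of the rational points of `E₁(ℚ_p)` -/

/-- For `‖r‖ ≤ 1 < ‖x‖` and a unit `u`: `‖u⁻²(x − r)‖ = ‖x‖ > 1` (the image of a point of `E₁` under
an integral change of variables lies in `E_{q,1}`). [folklore] -/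
private theorem one_lt_norm_toX {C : VariableChange ℚ_[p]} (hu : ‖(C.u : ℚ_[p])‖ = 1)
    (hr : ‖C.r‖ ≤ 1) {x : ℚ_[p]} (hx : 1 < ‖x‖) : 1 < ‖C.toX x‖ := by
  rw [VariableChange.toX_def, norm_mul, norm_pow, Units.val_inv_eq_inv_val, norm_inv, hu, inv_one,
    one_pow, one_mul]
  have hne : ‖x‖ ≠ ‖-C.r‖ := by rw [norm_neg]; exact (hr.trans_lt hx).ne'
  rw [sub_eq_add_neg, IsUltrametricDist.norm_add_eq_max_of_norm_ne_norm hne]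
  exact lt_max_of_lt_left hx

/-- **Every rational point of `E₁(ℚ_p)` has a one-unit Tate parameter** (ATAEC §V.4,
`φ(1 + 𝔪) = E_{q,1}`: the tree's `TateCurve.exists_tate_eq_of_one_lt_norm`): for `C` integral with
`C • (W ⊗ ℚ_p) = E_q` and `P = (x,y) ∈ E(ℚ)` with `‖x‖_p > 1`, there is `t ∈ ℚ_p`, `0 < ‖t‖ < 1`, with
`(X(1+t,q), Y(1+t,q))` the image `(u⁻²(x−r), u⁻³(y − s(x−r) − t_C))` of `P` on `E_q`.
[Silverman ATAEC §V.4 (PDF p. 401); Stein–Wuthrich 2013, §4.2 ("`u ∈ 1 + pℤ_p` is the unique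
preimage of `P ∈ Ê(pℤ_p)`")] [cite: SilvermanATAEC1994, §V.4 (PDF p. 401)]
[cite: SteinWuthrich2013, §4.2 (p. 15)] -/
theorem exists_oneUnit_tate_eq [W.IsElliptic] (Dq : TateParameterData W p) {C : VariableChange ℚ_[p]}
    (hC : C • W.baseChange ℚ_[p] = tateCurve Dq.q) (hu : ‖(C.u : ℚ_[p])‖ = 1) (hr : ‖C.r‖ ≤ 1)
    {x y : ℚ} (h : W.toAffine.Nonsingular x y) (hx : 1 < ‖(x : ℚ_[p])‖) :
    ∃ t : ℚ_[p], t ≠ 0 ∧ ‖t‖ < 1 ∧ tateX Dq.q (1 + t) = C.toX (x : ℚ_[p]) ∧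
      tateY Dq.q (1 + t) = C.toY (x : ℚ_[p]) (y : ℚ_[p]) := by
  have hq0 := Dq.q_ne_zero
  have hq := Dq.norm_q_lt_one
  have hns : (W.baseChange ℚ_[p]).toAffine.Nonsingular (x : ℚ_[p]) (y : ℚ_[p]) :=
    nonsingular_ratCast h
  have hns' : (tateCurve Dq.q).toAffine.Nonsingular (C.toX (x : ℚ_[p])) (C.toY (x : ℚ_[p]) (y : ℚ_[p])) := by
    rw [← hC]; exact (VariableChange.nonsingular_iff _ C _ _).mpr hns
  have honCurve : ∀ u : ℚ_[p], ‖u‖ = 1 → u ≠ 1 →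
      tateY Dq.q u ^ 2 + tateX Dq.q u * tateY Dq.q u =
        tateX Dq.q u ^ 3 + tateA4 Dq.q * tateX Dq.q u + tateA6 Dq.q := by
    intro u hu1 hne
    have hu0 : u ≠ 0 := by intro h0; rw [h0, norm_zero] at hu1; exact zero_ne_one hu1
    exact tate_onCurve' hq0 hq (Units.mk0 u hu0) (ne_zpow_of_norm_eq_one hq hu1 hne)
  exact exists_tate_eq_of_one_lt_norm (by norm_num) hq honCurve (tate_eq_of_nonsingular hns')
    (one_lt_norm_toX hu hr hx)

/-- **The uniformisation data at a split multiplicative prime, in Stein–Wuthrich's coordinates.**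
For `W/ℚ` globally minimal and `Dq : TateParameterData W p` (`q = Dq.q`) there are an integral
change of variables `C = (u,r,s,t)` with `C • (W ⊗ ℚ_p) = E_q`, `‖u‖ = 1`, `‖r‖ ≤ 1`,
`(u⁻¹)² = uniformisationScaleSq W p q` (SW's `C²`), and one-unit parameters `υ(P) ∈ 1 + pℤ_p`,
`υ(P) ≠ 1`, of the rational points `P = (x,y)` of `E₁(ℚ_p)` such that `υ(P) ∉ q^ℤ`,
`(X(υ(P)), Y(υ(P))) = (u⁻²(x − r), u⁻³(y − s(x−r) − t))` (the image of `P` on `E_q`),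
`υ(P+Q) = υ(P)υ(Q)` and `υ(P−Q) = υ(P)υ(Q)⁻¹` (Silverman ATAEC V.3.1 (c),(d), §V.4, V.5.3; AEC
VII.1.3(b); SW 2013 §4.2). These are the hypotheses `hC`, `hυ0`, `hυX`, `hυadd`, `hυsub` of
`tateSigma_theta_of_uniformization` over `K = ℚ_p` (`C_SW = u⁻¹`, shift `−u⁻²r`).
[Silverman ATAEC Thm. V.3.1 (c), §V.4, Thm. V.5.3; Stein–Wuthrich 2013, §4.2 (p. 15)]
[cite: SilvermanATAEC1994, Thm. V.3.1 (c) and Thm. V.5.3 (PDF pp. 395–409)]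
[cite: SteinWuthrich2013, §4.2 (p. 15)] -/
theorem exists_splitUniformizationData [W.IsElliptic] [W.IsGloballyMinimal]
    (Dq : TateParameterData W p) :
    ∃ (C : VariableChange ℚ_[p]) (υ : ℚ → ℚ → ℚ_[p]),
      C • W.baseChange ℚ_[p] = tateCurve Dq.q ∧ ‖(C.u : ℚ_[p])‖ = 1 ∧ ‖C.r‖ ≤ 1 ∧
      ((C.u : ℚ_[p])⁻¹) ^ 2 = uniformisationScaleSq W p Dq.q ∧
      (∀ {x y : ℚ} (_ : W.toAffine.Nonsingular x y), 1 < ‖(x : ℚ_[p])‖ →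
        υ x y ≠ 0 ∧ ‖υ x y - 1‖ < 1 ∧ υ x y ≠ 1 ∧ (∀ n : ℤ, υ x y ≠ Dq.q ^ n) ∧
          tateX Dq.q (υ x y) = C.toX (x : ℚ_[p]) ∧
          tateY Dq.q (υ x y) = C.toY (x : ℚ_[p]) (y : ℚ_[p])) ∧
      (∀ {x₁ y₁ x₂ y₂ x₃ y₃ : ℚ} (h₁ : W.toAffine.Nonsingular x₁ y₁)
        (h₂ : W.toAffine.Nonsingular x₂ y₂) (h₃ : W.toAffine.Nonsingular x₃ y₃),
        1 < ‖(x₁ : ℚ_[p])‖ → 1 < ‖(x₂ : ℚ_[p])‖ →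
        (.some x₁ y₁ h₁ : W.toAffine.Point) + .some x₂ y₂ h₂ = .some x₃ y₃ h₃ →
          υ x₃ y₃ = υ x₁ y₁ * υ x₂ y₂) ∧
      (∀ {x₁ y₁ x₂ y₂ x₄ y₄ : ℚ} (h₁ : W.toAffine.Nonsingular x₁ y₁)
        (h₂ : W.toAffine.Nonsingular x₂ y₂) (h₄ : W.toAffine.Nonsingular x₄ y₄),
        1 < ‖(x₁ : ℚ_[p])‖ → 1 < ‖(x₂ : ℚ_[p])‖ →
        (.some x₁ y₁ h₁ : W.toAffine.Point) - .some x₂ y₂ h₂ = .some x₄ y₄ h₄ →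
          υ x₄ y₄ = υ x₁ y₁ * (υ x₂ y₂)⁻¹) := by
  have hq0 := Dq.q_ne_zero
  have hq := Dq.norm_q_lt_one
  obtain ⟨C, hC, hu, hr, -, -⟩ := exists_variableChange_tateCurve Dq
  set E := W.baseChange ℚ_[p] with hE
  set T := C • E with hT
  set q := Dq.q with hqdef
  -- the parameters
  have key := fun (x y : ℚ) (h : W.toAffine.Nonsingular x y) (hx : 1 < ‖(x : ℚ_[p])‖) =>
    exists_oneUnit_tate_eq Dq hC hu hr h hx
  choose tfun htfun using key
  let υ : ℚ → ℚ → ℚ_[p] := fun x y =>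
    if hh : ∃ h : W.toAffine.Nonsingular x y, 1 < ‖(x : ℚ_[p])‖ then 1 + tfun x y hh.1 hh.2 else 1
  have hυ : ∀ {x y : ℚ} (h : W.toAffine.Nonsingular x y), 1 < ‖(x : ℚ_[p])‖ →
      υ x y ≠ 0 ∧ ‖υ x y - 1‖ < 1 ∧ υ x y ≠ 1 ∧ (∀ n : ℤ, υ x y ≠ q ^ n) ∧
        tateX q (υ x y) = C.toX (x : ℚ_[p]) ∧ tateY q (υ x y) = C.toY (x : ℚ_[p]) (y : ℚ_[p]) := by
    intro x y h hx
    have hh : ∃ h : W.toAffine.Nonsingular x y, 1 < ‖(x : ℚ_[p])‖ := ⟨h, hx⟩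
    have hυxy : υ x y = 1 + tfun x y hh.1 hh.2 := dif_pos hh
    obtain ⟨ht0, ht1, hX, hY⟩ := htfun x y hh.1 hh.2
    have hnorm1 : ‖υ x y - 1‖ < 1 := by rw [hυxy, add_sub_cancel_left]; exact ht1
    have hnorm : ‖υ x y‖ = 1 := by
      have := IsUltrametricDist.norm_add_eq_max_of_norm_ne_norm (x := υ x y - 1) (y := (1 : ℚ_[p]))
        (by rw [norm_one]; exact hnorm1.ne)
      rw [sub_add_cancel, norm_one, max_eq_right hnorm1.le] at this
      exact this
    have hne1 : υ x y ≠ 1 := by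
      rw [hυxy]; intro h1; exact ht0 (by linear_combination h1)
    refine ⟨fun h0 => by rw [h0, norm_zero] at hnorm; exact zero_ne_one hnorm, hnorm1, hne1,
      fun n => ne_zpow_of_norm_eq_one hq hnorm hne1 n, ?_, ?_⟩
    · rw [hυxy]; exact hX
    · rw [hυxy]; exact hY
  -- `1 < ‖j‖` (split multiplicative)
  have hj : 1 < ‖(W.j : ℚ_[p])‖ := Dq.split.one_lt_norm_j
  refine ⟨C, υ, hC, hu, hr, (uniformisationScaleSq_eq hC hj).symm, hυ, ?_, ?_⟩
  · -- multiplicativity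
    intro x₁ y₁ x₂ y₂ x₃ y₃ h₁ h₂ h₃ hx₁ hx₂ hS
    obtain ⟨h0₁, hn₁, -, hq₁, hX₁, hY₁⟩ := hυ h₁ hx₁
    obtain ⟨h0₂, hn₂, -, hq₂, hX₂, hY₂⟩ := hυ h₂ hx₂
    -- the sum `(x₃, y₃)` lies in `E₁(ℚ_p)` again
    have hx₃ : 1 < ‖(x₃ : ℚ_[p])‖ := by
      have hk := E.isInReductionKernel_add
        (P := W.toPadicPoint p (.some x₁ y₁ h₁)) (Q := W.toPadicPoint p (.some x₂ y₂ h₂))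
        (by rw [toPadicPoint_some]; exact hx₁) (by rw [toPadicPoint_some]; exact hx₂)
      rw [← map_add, hS, toPadicPoint_some] at hk
      exact hk
    obtain ⟨h0₃, hn₃, -, hq₃, hX₃, hY₃⟩ := hυ h₃ hx₃
    -- the images on `T = C • E`
    have hT₁ : T.toAffine.Nonsingular (C.toX (x₁ : ℚ_[p])) (C.toY (x₁ : ℚ_[p]) (y₁ : ℚ_[p])) :=
      (VariableChange.nonsingular_iff _ C _ _).mpr (nonsingular_ratCast h₁)
    have hT₂ : T.toAffine.Nonsingular (C.toX (x₂ : ℚ_[p])) (C.toY (x₂ : ℚ_[p]) (y₂ : ℚ_[p])) :=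
      (VariableChange.nonsingular_iff _ C _ _).mpr (nonsingular_ratCast h₂)
    have hT₃ : T.toAffine.Nonsingular (C.toX (x₃ : ℚ_[p])) (C.toY (x₃ : ℚ_[p]) (y₃ : ℚ_[p])) :=
      (VariableChange.nonsingular_iff _ C _ _).mpr (nonsingular_ratCast h₃)
    have hST : (.some _ _ hT₁ : T.toAffine.Point) + .some _ _ hT₂ = .some _ _ hT₃ := by
      have e₁ := VariableChange.pointEquiv_some E C (nonsingular_ratCast (p := p) h₁)
      have e₂ := VariableChange.pointEquiv_some E C (nonsingular_ratCast (p := p) h₂)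
      have e₃ := VariableChange.pointEquiv_some E C (nonsingular_ratCast (p := p) h₃)
      have hsum := map_add (VariableChange.pointEquiv E C) (W.toPadicPoint p (.some x₁ y₁ h₁))
        (W.toPadicPoint p (.some x₂ y₂ h₂))
      rw [← map_add, hS, toPadicPoint_some, toPadicPoint_some, toPadicPoint_some, e₁, e₂, e₃]
        at hsum
      exact hsum.symm
    obtain ⟨hq₁₂, hX₁₂, hY₁₂⟩ := tate_coords_add hq0 hq T hC (u := Units.mk0 _ h0₁)
      (v := Units.mk0 _ h0₂) hq₁ hq₂ hT₁ hT₂ hT₃ hX₁ hY₁ hX₂ hY₂ hST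
    have huniq := oneUnit_eq_of_tate_eq hq0 hq (u := Units.mk0 _ h0₃)
      (u' := Units.mk0 _ h0₁ * Units.mk0 _ h0₂) hn₃ (by
        rw [Units.val_mul, Units.val_mk0, Units.val_mk0]
        have e : υ x₁ y₁ * υ x₂ y₂ - 1 = (υ x₁ y₁ - 1) * υ x₂ y₂ + (υ x₂ y₂ - 1) := by ring
        rw [e]
        have hn2 : ‖υ x₂ y₂‖ ≤ 1 := by
          calc ‖υ x₂ y₂‖ = ‖(υ x₂ y₂ - 1) + 1‖ := by rw [sub_add_cancel]
            _ ≤ max ‖υ x₂ y₂ - 1‖ ‖(1 : ℚ_[p])‖ := Padic.nonarchimedean _ _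
            _ ≤ 1 := max_le hn₂.le (by rw [norm_one])
        calc ‖(υ x₁ y₁ - 1) * υ x₂ y₂ + (υ x₂ y₂ - 1)‖
            ≤ max ‖(υ x₁ y₁ - 1) * υ x₂ y₂‖ ‖υ x₂ y₂ - 1‖ := Padic.nonarchimedean _ _
          _ < 1 := max_lt (by
              rw [norm_mul]
              calc ‖υ x₁ y₁ - 1‖ * ‖υ x₂ y₂‖ ≤ ‖υ x₁ y₁ - 1‖ * 1 :=
                    mul_le_mul_of_nonneg_left hn2 (norm_nonneg _)
                _ < 1 := by rw [mul_one]; exact hn₁) hn₂)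
      hq₃ hq₁₂ (by rw [Units.val_mk0, hX₃, hX₁₂]) (by rw [Units.val_mk0, hY₃, hY₁₂])
    have := congrArg (fun w : ℚ_[p]ˣ => (w : ℚ_[p])) huniq
    simpa only [Units.val_mul, Units.val_mk0] using this
  · -- the difference
    intro x₁ y₁ x₂ y₂ x₄ y₄ h₁ h₂ h₄ hx₁ hx₂ hD
    obtain ⟨h0₁, hn₁, -, hq₁, hX₁, hY₁⟩ := hυ h₁ hx₁
    obtain ⟨h0₂, hn₂, -, hq₂, hX₂, hY₂⟩ := hυ h₂ hx₂
    have hx₄ : 1 < ‖(x₄ : ℚ_[p])‖ := by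
      have hk := E.isInReductionKernel_add
        (P := W.toPadicPoint p (.some x₁ y₁ h₁)) (Q := W.toPadicPoint p (-(.some x₂ y₂ h₂)))
        (by rw [toPadicPoint_some]; exact hx₁)
        (by rw [map_neg, toPadicPoint_some, Affine.Point.neg_some]; exact hx₂)
      rw [← map_add, ← sub_eq_add_neg, hD, toPadicPoint_some] at hk
      exact hk
    obtain ⟨h0₄, hn₄, -, hq₄, hX₄, hY₄⟩ := hυ h₄ hx₄
    have hT₁ : T.toAffine.Nonsingular (C.toX (x₁ : ℚ_[p])) (C.toY (x₁ : ℚ_[p]) (y₁ : ℚ_[p])) :=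
      (VariableChange.nonsingular_iff _ C _ _).mpr (nonsingular_ratCast h₁)
    have hT₂ : T.toAffine.Nonsingular (C.toX (x₂ : ℚ_[p])) (C.toY (x₂ : ℚ_[p]) (y₂ : ℚ_[p])) :=
      (VariableChange.nonsingular_iff _ C _ _).mpr (nonsingular_ratCast h₂)
    have hT₂' : T.toAffine.Nonsingular (C.toX (x₂ : ℚ_[p]))
        (T.toAffine.negY (C.toX (x₂ : ℚ_[p])) (C.toY (x₂ : ℚ_[p]) (y₂ : ℚ_[p]))) :=
      (Affine.nonsingular_neg _ _).mpr hT₂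
    have hT₄ : T.toAffine.Nonsingular (C.toX (x₄ : ℚ_[p])) (C.toY (x₄ : ℚ_[p]) (y₄ : ℚ_[p])) :=
      (VariableChange.nonsingular_iff _ C _ _).mpr (nonsingular_ratCast h₄)
    have hN : -(.some _ _ hT₂ : T.toAffine.Point) = .some _ _ hT₂' := Affine.Point.neg_some hT₂
    obtain ⟨hq₂', hX₂', hY₂'⟩ := tate_coords_neg hq0 hq T hC (u := Units.mk0 _ h0₂) hq₂ hT₂ hT₂'
      hX₂ hY₂ hN
    have hST : (.some _ _ hT₁ : T.toAffine.Point) + .some _ _ hT₂' = .some _ _ hT₄ := by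
      have e₁ := VariableChange.pointEquiv_some E C (nonsingular_ratCast (p := p) h₁)
      have e₂ := VariableChange.pointEquiv_some E C (nonsingular_ratCast (p := p) h₂)
      have e₄ := VariableChange.pointEquiv_some E C (nonsingular_ratCast (p := p) h₄)
      have hsum := map_add (VariableChange.pointEquiv E C) (W.toPadicPoint p (.some x₁ y₁ h₁))
        (W.toPadicPoint p (-(.some x₂ y₂ h₂)))
      rw [← map_add, ← sub_eq_add_neg, hD, map_neg, map_neg, toPadicPoint_some, toPadicPoint_some,
        toPadicPoint_some, e₁, e₂, e₄, hN] at hsum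
      exact hsum.symm
    obtain ⟨hq₁₂, hX₁₂, hY₁₂⟩ := tate_coords_add hq0 hq T hC (u := Units.mk0 _ h0₁)
      (v := (Units.mk0 _ h0₂)⁻¹) hq₁ hq₂' hT₁ hT₂' hT₄ hX₁ hY₁ hX₂' hY₂' hST
    have hn₂i : ‖(υ x₂ y₂)⁻¹ - 1‖ < 1 := by
      have hn2 : ‖υ x₂ y₂‖ = 1 := by
        have := IsUltrametricDist.norm_add_eq_max_of_norm_ne_norm (x := υ x₂ y₂ - 1)
          (y := (1 : ℚ_[p])) (by rw [norm_one]; exact hn₂.ne)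
        rw [sub_add_cancel, norm_one, max_eq_right hn₂.le] at this
        exact this
      have e : (υ x₂ y₂)⁻¹ - 1 = -((υ x₂ y₂)⁻¹ * (υ x₂ y₂ - 1)) := by field_simp; ring
      rw [e, norm_neg, norm_mul, norm_inv, hn2, inv_one, one_mul]
      exact hn₂
    have huniq := oneUnit_eq_of_tate_eq hq0 hq (u := Units.mk0 _ h0₄)
      (u' := Units.mk0 _ h0₁ * (Units.mk0 _ h0₂)⁻¹) hn₄ (by
        rw [Units.val_mul, Units.val_inv_eq_inv_val, Units.val_mk0, Units.val_mk0]
        have e : υ x₁ y₁ * (υ x₂ y₂)⁻¹ - 1 =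
            (υ x₁ y₁ - 1) * (υ x₂ y₂)⁻¹ + ((υ x₂ y₂)⁻¹ - 1) := by ring
        rw [e]
        have hn2 : ‖(υ x₂ y₂)⁻¹‖ ≤ 1 := by
          calc ‖(υ x₂ y₂)⁻¹‖ = ‖((υ x₂ y₂)⁻¹ - 1) + 1‖ := by rw [sub_add_cancel]
            _ ≤ max ‖(υ x₂ y₂)⁻¹ - 1‖ ‖(1 : ℚ_[p])‖ := Padic.nonarchimedean _ _
            _ ≤ 1 := max_le hn₂i.le (by rw [norm_one])
        calc ‖(υ x₁ y₁ - 1) * (υ x₂ y₂)⁻¹ + ((υ x₂ y₂)⁻¹ - 1)‖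
            ≤ max ‖(υ x₁ y₁ - 1) * (υ x₂ y₂)⁻¹‖ ‖(υ x₂ y₂)⁻¹ - 1‖ := Padic.nonarchimedean _ _
          _ < 1 := max_lt (by
              rw [norm_mul]
              calc ‖υ x₁ y₁ - 1‖ * ‖(υ x₂ y₂)⁻¹‖ ≤ ‖υ x₁ y₁ - 1‖ * 1 :=
                    mul_le_mul_of_nonneg_left hn2 (norm_nonneg _)
                _ < 1 := by rw [mul_one]; exact hn₁) hn₂i)
      hq₄ hq₁₂ (by rw [Units.val_mk0, hX₄, hX₁₂]) (by rw [Units.val_mk0, hY₄, hY₁₂])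
    have := congrArg (fun w : ℚ_[p]ˣ => (w : ℚ_[p])) huniq
    simpa only [Units.val_mul, Units.val_inv_eq_inv_val, Units.val_mk0] using this

end Literature.NumberTheory.EllipticCurves.SteinWuthrich2013

end
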